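import Mathlib.LinearAlgebra.Matrix.NonsingularInverse
import Mathlib.LinearAlgebra.Matrix.Block
import Mathlib.LinearAlgebra.LinearIndependent.Lemmas
import Mathlib.LinearAlgebra.Dimension.Constructions
import Mathlib.Algebra.Polynomial.Basic
import Mathlib.RingTheory.Polynomial.Basic
import HarnessLib

/-!
# A divisibility criterion for determinants along a line (towards Roy 2013, Theorem 5.2)

Topic `Literature/NumberTheory/Transcendental`. Part of the formalisation of the proof of Roy 2013,
Theorem 1.1 (named fact `roy2013_thm_1_1`, `RoySmallValueEstimates.lean`). Source: D. Roy,
*A small value estimate for `𝔾ₐ × 𝔾ₘ`*, Mathematika 59 (2013) 333–363 = arXiv:1301.0663, §5,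
proof of Theorem 5.2 (p. 13): "there is also a basis `𝓑` of `ℂ[X]_ν` whose last elements past
the first `deg(I)` form a basis of `I_ν` … For each `Q ∈ I_D^{m+1}`, the first `deg(I)` rows of
`M_Q` vanish because the image of `φ_Q` is contained in `I_ν`. It follows from this that all
partial derivatives of `Φ` of order less than `deg(I)` vanish at each point of `I_D^{m+1}`."

The linear-algebra content, in the form used by Proposition 6.1 (restriction to a line): let
`L` be a `κ × ι` matrix admitting a right inverse (`L N = 1`: `#κ` independent linear
functionals on `K^ι`), and `A, B` square `ι × ι` matrices with `L A = 0` (the columns of `A` are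
killed by the functionals). Then **`X^{#κ}` divides `det(A + X B)`** in `K[X]`
(`X_pow_card_dvd_det_line`). Proof: choose `#κ` columns of `L` forming an invertible minor
(`exists_embedding_isUnit_submatrix`), let `B₀` be the identity matrix with the corresponding
rows replaced by the rows of `L` (`rowOp`, invertible); then those rows of `B₀ (A + XB)` are
divisible by `X`.

One definition (`rowOp`); everything here is proved; no new named facts.

## References

* [Roy2013] D. Roy, *A small value estimate for 𝔾ₐ × 𝔾ₘ*, Mathematika 59 (2013), 333–363
  (arXiv:1301.0663), §5, proof of Theorem 5.2.
-/

noncomputable section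

open Matrix Finset Polynomial

namespace Literature.NumberTheory.Transcendental

namespace Roy2013

variable {K : Type*} [Field K] {ι κ : Type*} [Fintype ι] [Fintype κ] [DecidableEq ι] [DecidableEq κ]

/-! ### An invertible maximal minor of a matrix with a right inverse -/

omit [DecidableEq ι] in
/-- If `L N = 1` then `#κ` suitable columns of `L` form an invertible square matrix.
[folklore] -/
theorem exists_embedding_isUnit_submatrix (L : Matrix κ ι K) (N : Matrix ι κ K) (hLN : L * N = 1) :
    ∃ f : κ ↪ ι, IsUnit (L.submatrix id f) := by
  classical
  -- the columns of `L` span `κ → K`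
  have hspan : Submodule.span K (Set.range L.col) = ⊤ := by
    rw [eq_top_iff]
    intro w _
    have hw : w = L *ᵥ (N *ᵥ w) := by rw [mulVec_mulVec, hLN, one_mulVec]
    rw [hw, mulVec_eq_sum]
    refine Submodule.sum_mem _ fun i _ => ?_
    rw [op_smul_eq_smul]
    exact Submodule.smul_mem _ _ (Submodule.subset_span ⟨i, rfl⟩)
  -- extract a basis among the columns
  obtain ⟨b, hb, hbspan, hli⟩ := exists_linearIndependent K (Set.range L.col)
  rw [hspan] at hbspan
  have hbfin : b.Finite := (Set.finite_range _).subset hb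
  haveI : Fintype b := hbfin.fintype
  have basis : Module.Basis b K (κ → K) :=
    Module.Basis.mk hli (by rw [Subtype.range_coe_subtype, Set.setOf_mem_eq, hbspan])
  have hcard : Fintype.card κ = Fintype.card b := by
    rw [← Module.finrank_eq_card_basis basis, Module.finrank_fintype_fun_eq_card]
  obtain ⟨e⟩ := Fintype.truncEquivOfCardEq hcard |>.nonempty
  -- choose a column index above each basis vector
  have hpre : ∀ x : b, ∃ i : ι, L.col i = x := fun x => hb x.2
  choose pre hpre using hpre
  have hinj : Function.Injective (fun k : κ => pre (e k)) := by
    intro k k' h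
    have h' : pre (e k) = pre (e k') := h
    have : (e k : κ → K) = e k' := by rw [← hpre (e k), ← hpre (e k'), h']
    exact e.injective (Subtype.ext this)
  refine ⟨⟨fun k => pre (e k), hinj⟩, ?_⟩
  rw [← linearIndependent_cols_iff_isUnit]
  have hcol : (L.submatrix id fun k => pre (e k)).col = fun k => ((e k : b) : κ → K) := by
    ext k j
    change L j (pre (e k)) = (e k : κ → K) j
    rw [← hpre (e k)]; rfl
  rw [show (L.submatrix id (⟨fun k => pre (e k), hinj⟩ : κ ↪ ι)).col =
    fun k => ((e k : b) : κ → K) from hcol]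
  exact hli.comp e e.injective

/-! ### Replacing rows of the identity by the rows of `L` -/

open scoped Classical in
/-- The identity matrix of size `ι` with the rows at the positions `f k` replaced by the rows
`L k` of `L`. [folklore] -/
def rowOp (L : Matrix κ ι K) (f : κ ↪ ι) : Matrix ι ι K :=
  Matrix.of fun i j => if h : i ∈ Set.range f then L ((Equiv.ofInjective f f.injective).symm ⟨i, h⟩) j
    else (1 : Matrix ι ι K) i j

omit [Fintype ι] [DecidableEq κ] in
/-- The row of `rowOp L f` at `f k` is `L k`. [folklore] -/
theorem rowOp_apply_range (L : Matrix κ ι K) (f : κ ↪ ι) (k : κ) (j : ι) :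
    rowOp L f (f k) j = L k j := by
  classical
  rw [rowOp, Matrix.of_apply, dif_pos ⟨k, rfl⟩, Equiv.ofInjective_symm_apply]


omit [Fintype ι] [DecidableEq κ] in
/-- The other rows are rows of the identity. [folklore] -/
theorem rowOp_apply_notMem (L : Matrix κ ι K) (f : κ ↪ ι) {i : ι} (hi : i ∉ Set.range f) (j : ι) :
    rowOp L f i j = (1 : Matrix ι ι K) i j := by
  classical
  rw [rowOp, Matrix.of_apply, dif_neg hi]

/-- `det (rowOp L f) = det (L restricted to the columns f k)`, in particular a unit when that
minor is. [folklore] -/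
theorem isUnit_det_rowOp (L : Matrix κ ι K) (f : κ ↪ ι) (hL : IsUnit (L.submatrix id f)) :
    IsUnit (rowOp L f).det := by
  classical
  -- reindex `ι ≃ κ ⊕ {i // i ∉ range f}`
  set e : κ ⊕ {i // ¬ (i ∈ Set.range f)} ≃ ι :=
    (Equiv.sumCongr (Equiv.ofInjective f f.injective) (Equiv.refl _)).trans
      (Equiv.sumCompl fun i => i ∈ Set.range f) with he
  have he_inl : ∀ k, e (Sum.inl k) = f k := fun k => by simp [he]
  have he_inr : ∀ i, e (Sum.inr i) = i.1 := fun i => by simp [he]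
  have hblock : (rowOp L f).submatrix e e =
      Matrix.fromBlocks (L.submatrix id f) (Matrix.of fun k i => L k (i.1 : ι)) 0 1 := by
    ext (k | i) (k' | i')
    · rw [submatrix_apply, he_inl, he_inl, rowOp_apply_range, fromBlocks_apply₁₁, submatrix_apply]
      rfl
    · rw [submatrix_apply, he_inl, he_inr, rowOp_apply_range, fromBlocks_apply₁₂, of_apply]
    · rw [submatrix_apply, he_inr, he_inl, rowOp_apply_notMem L f i.2, fromBlocks_apply₂₁,
        Matrix.zero_apply, Matrix.one_apply_ne]
      exact fun h => i.2 ⟨k', h.symm⟩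
    · rw [submatrix_apply, he_inr, he_inr, rowOp_apply_notMem L f i.2, fromBlocks_apply₂₂]
      by_cases h : i = i'
      · subst h; simp
      · rw [Matrix.one_apply_ne (fun h' => h (Subtype.ext h')), Matrix.one_apply_ne h]
  have hdet : (rowOp L f).det = (L.submatrix id f).det := by
    rw [← det_submatrix_equiv_self e, hblock, det_fromBlocks_zero₂₁, det_one, mul_one]
  rw [hdet]
  exact (isUnit_iff_isUnit_det _).mp hL

/-! ### The divisibility criterion -/

/-- **Line multiplicity.** Let `L` be a `κ × ι` matrix with a right inverse (`L N = 1`) and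
`A, B` square matrices with `L A = 0`. Then `X^{#κ} ∣ det (A + X B)` in `K[X]` (the `#κ`
functionals `L` kill all columns of `A`, so after an invertible row operation `#κ` rows of
`A + XB` become divisible by `X`). [cite: Roy2013, §5, proof of Theorem 5.2] -/
theorem X_pow_card_dvd_det_line (L : Matrix κ ι K) (N : Matrix ι κ K) (hLN : L * N = 1)
    (A B : Matrix ι ι K) (hLA : L * A = 0) :
    (Polynomial.X : K[X]) ^ Fintype.card κ ∣
      (A.map Polynomial.C + (Polynomial.X : K[X]) • B.map Polynomial.C).det := by
  classical
  obtain ⟨f, hf⟩ := exists_embedding_isUnit_submatrix L N hLN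
  set B₀ : Matrix ι ι K := rowOp L f with hB₀
  set Mz : Matrix ι ι K[X] := A.map Polynomial.C + (Polynomial.X : K[X]) • B.map Polynomial.C with hMz
  -- rows `f k` of `B₀ Mz` are `X` times rows of `B₀ B`
  have hrow : ∀ k j, (B₀.map Polynomial.C * Mz) (f k) j =
      Polynomial.X * Polynomial.C ((B₀ * B) (f k) j) := by
    intro k j
    have h0 : (B₀ * A) (f k) j = 0 := by
      rw [Matrix.mul_apply]
      calc ∑ i, B₀ (f k) i * A i j = ∑ i, L k i * A i j :=
            Finset.sum_congr rfl fun i _ => by rw [hB₀, rowOp_apply_range]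
        _ = (L * A) k j := (Matrix.mul_apply).symm
        _ = 0 := by rw [hLA, Matrix.zero_apply]
    rw [hMz, Matrix.mul_add, Matrix.add_apply, ← Matrix.map_mul, Matrix.map_apply, h0, map_zero,
      zero_add, Matrix.mul_smul, Matrix.smul_apply, ← Matrix.map_mul, Matrix.map_apply, smul_eq_mul]
  -- factor `X` out of these rows
  set v : ι → K[X] := fun i => if i ∈ Set.range f then Polynomial.X else 1 with hv
  set M' : Matrix ι ι K[X] := Matrix.of fun i j =>
    if i ∈ Set.range f then Polynomial.C ((B₀ * B) i j) else (B₀.map Polynomial.C * Mz) i j with hM'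
  have hfac : B₀.map Polynomial.C * Mz = Matrix.of fun i j => v i * M' i j := by
    ext i j
    rw [Matrix.of_apply, hv, hM']
    dsimp only
    rw [Matrix.of_apply]
    by_cases hi : i ∈ Set.range f
    · obtain ⟨k, rfl⟩ := hi
      rw [if_pos ⟨k, rfl⟩, if_pos ⟨k, rfl⟩, hrow]
    · rw [if_neg hi, if_neg hi, one_mul]
  have hfilter : (Finset.univ.filter fun i => i ∈ Set.range f) = Finset.univ.map f := by
    ext i
    simp only [Finset.mem_filter, Finset.mem_univ, true_and, Set.mem_range, Finset.mem_map]
  have hprod : ∏ i, v i = (Polynomial.X : K[X]) ^ Fintype.card κ := by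
    rw [hv]
    dsimp only
    rw [Finset.prod_ite, Finset.prod_const, Finset.prod_const_one, mul_one, hfilter,
      Finset.card_map, Finset.card_univ]
  have hdetB₀ : IsUnit (B₀.map Polynomial.C).det := by
    rw [← RingHom.mapMatrix_apply, ← RingHom.map_det]
    exact (isUnit_det_rowOp L f hf).map _
  have hkey : (Polynomial.X : K[X]) ^ Fintype.card κ ∣ (B₀.map Polynomial.C).det * Mz.det := by
    rw [← det_mul, hfac, det_mul_column, hprod]
    exact Dvd.intro _ rfl
  exact (hdetB₀.dvd_mul_left).mp hkey

end Roy2013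

end Literature.NumberTheory.Transcendental
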